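import Literature.IUT.HodgeTheaters.InitialThetaDataCor12Derived
import Literature.AnabelianGeometry.AbsoluteAnabelian.AbsTopII.Remark332Proofs
import Literature.AnabelianGeometry.AbsoluteAnabelian.AbsTopII.SemiEllipticTransport
import HarnessLib

/-!
# [IUTchI] Cor. 1.2: the anabelian inputs SPLIT — [AbsTopI] Thm. 2.6 (v)(vi) and [AbsTopII] Cor. 3.3 (ii)
# consumed BY NAME from layer L4 — proofs only

S. Mochizuki, *Inter-universal Teichmüller theory I*, kurims manuscript (May 2020), §1, Corollary 1.2,
p. 39 ([IUTchI] Cor 1.2 p.39) [claim: Mochizuki2012, status: disputed].  Its proof (p. 39, quoted as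
printed): "one may recover the subgroup `Δ_{X̲→} ⊆ Π_{X̲→}` via the algorithms of [AbsTopI], Theorem 2.6,
(v), (vi). Next, we recall that the algorithms of [AbsTopII], Corollary 3.3, (i), (ii) — which are
applicable in light of [AbsTopI], Example 4.8 — allow one to reconstruct `Π_C` [together with the
natural inclusion `Π_{X̲→} ↪ Π_C`], as well as the subgroups `Δ_X ⊆ Δ_C ⊆ Π_C`."

`Proofs` companion of abc-iut-L5-d4's `PuncturedEllipticCoveringsCor12Assembly` (p432882),
`…Cor12Respd` (p433266) and `InitialThetaDataCor12Derived` (p434154) — theorems only, no definitions,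
nothing restated.  There the typed Cor. 1.2 (`CharacteristicNatureOfCoverings`, abc-iut-L5-t1) was
derived from COMPOSITE pair-level binders `hcore` / `hcoreC`: "every bicontinuous isomorphism
`Π_{X̲→} ⥲ Π'_{X̲→}` (resp. `Π_{C̲→} ⥲ Π'_{C̲→}`) extends to a bicontinuous `Θ : Π_C ⥲ Π'_C` WITH
`Θ(Δ_X) = Δ'_X` AND `Θ(Δ_C) = Δ'_C`".  HERE the two `Δ`-clauses are DERIVED from layer L4's typed
statements, consumed BY NAME:

* `Θ(Δ_C) = Δ'_C` — from abc-iut-L4-t4's typed [AbsTopI] Thm. 2.6 (vi) `FundamentalExtension.Thm26vi`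
  (`k` an NF; FACT-LIST F-0250) at the two cores, through abc-iut-L4-t6's KERNEL theorem
  `FundamentalExtension.geom_map_eq_of_geomIsMaxTFGNormalIn` ([AbsTopII] Rmk. 3.3.2: the maximal
  topologically finitely generated closed normal subgroup is carried along every isomorphism of
  topological groups); MLF variant from `FundamentalExtension.Thm26v` (F-0249) through
  `FundamentalExtension.preservesGeom_of_thm26v` (`map_deltaC_eq_of_thm26vi`, `map_deltaC_eq_of_thm26v`);
* `Θ(Δ_X) = Δ'_X` — from two SINGLE-DATUM side conditions in abc-iut-L4-t6's Cor. 3.3 (ii) vocabulary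
  `AbsTopII.semiEllipticDoubleCoverSubgroups` ("the collection of open subgroups `J ⊆ Π_C` of index `2`
  such that `J ∩ Δ_C` is torsion-free [i.e., the covering determined by `J` is a scheme — cf. [AbsTopI],
  Lemma 4.1, (iv)]", [AbsTopII] Cor. 3.3 (ii) p. 68): `htf` — `Δ_X = Π_X ∩ Δ_C` is torsion-free (`X` is
  a scheme), so `Π_X` belongs to the collection; `huniq'` — every member `J` of the collection for the
  primed datum has `J ∩ Δ'_C = Δ'_X` ([AbsTopII] Cor. 3.3 (ii) with Rmk. 3.1.1 p. 65: the double
  covering "`D_k̄ → C_k̄`" of `C_k̄` by a hyperbolic curve is unique); the transport along `Θ` is L4's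
  kernel theorem `AbsTopII.map_mem_semiEllipticDoubleCoverSubgroups` (`map_deltaX_eq_of_semiElliptic`).

What REMAINS of `hcore` / `hcoreC` is the pure [AbsTopII] Cor. 3.3 (i) content `hext` / `hextC`: every
bicontinuous isomorphism `Π_{X̲→} ⥲ Π'_{X̲→}` (resp. `Π_{C̲→} ⥲ Π'_{C̲→}`) EXTENDS to some isomorphism of
topological groups `Π_C ⥲ Π'_C` (the `k`-core reconstructed from `Π_{X̲→}`, bi-anabelian form) — a
hypothesis, never asserted (`core_extension_of_thm26vi`, `core_extension_of_thm26v`).  Assembled: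
`characteristicNatureOfCoverings_of_thm26vi` / `_of_thm26v`, and at the `K`-level §1 datum of two
initial Θ-data (Def. 3.1 (d): `K` a number field, so Thm. 2.6 (vi))
`InitialThetaData.pe_characteristicNatureOfCoverings_of_thm26vi` — binders: the printed claims of p. 38
(`ArrowCoveringClaims`), the cusp interfaces (`CuspGalois`), the printed ramification of `ε⁰`
(GAP-LEDGER G-L5d4g6-1), `hext`/`hextC`, `Thm26vi` ×2 BY NAME, `htf`, `huniq'`, and the [AbsTopI] Lem. 4.5
shapes `hLem45`/`hLem45C` (unchanged).

HONEST FRAMING: binders are assumption labels; typed ≠ discharged for the anabelian inputs and for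
`Thm26vi` (abc-iut-L4's node); nothing here takes a side on [IUTchIII] Cor. 3.12; no printed statement
is strengthened.
-/

namespace Literature.IUT.HodgeTheaters

namespace PuncturedEllipticData

open scoped Pointwise
open Literature.AnabelianGeometry.AbsoluteAnabelian
open Literature.AnabelianGeometry.AbsoluteAnabelian.AbsTopII (semiEllipticDoubleCoverSubgroups
  map_mem_semiEllipticDoubleCoverSubgroups)

universe u

variable {D D' : PuncturedEllipticData.{u}}

/-! ### `Θ(Δ_C) = Δ'_C` from [AbsTopI] Thm. 2.6 (vi) / (v), by name -/

/-- **"one may recover the subgroup `Δ` via the algorithms of [AbsTopI], Theorem 2.6, (v), (vi)"**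
(Cor. 1.2 proof p. 39), `k` an NF: if both cores `Π_C ↠ G_k`, `Π'_C ↠ G_{k'}` satisfy abc-iut-L4's
typed [AbsTopI] Thm. 2.6 (vi) (`Thm26vi`: `Δ` is the maximal topologically finitely generated closed
normal subgroup of `Π`), then EVERY isomorphism of topological groups `Θ : Π_C ⥲ Π'_C` carries `Δ_C`
onto `Δ'_C` — abc-iut-L4-t6's `geom_map_eq_of_geomIsMaxTFGNormalIn` ([AbsTopII] Rmk. 3.3.2).
([IUTchI] Cor 1.2 p.39) [claim: Mochizuki2012, status: disputed] -/
theorem map_deltaC_eq_of_thm26vi (h26 : D.E.Thm26vi) (h26' : D'.E.Thm26vi)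
    (Θ : D.PiC ≃ₜ* D'.PiC) : D.DeltaC.map Θ.toMulEquiv.toMonoidHom = D'.DeltaC :=
  FundamentalExtension.geom_map_eq_of_geomIsMaxTFGNormalIn h26.2.1 h26'.2.1 Θ

/-- The same for `k`, `k'` MLF's, from abc-iut-L4's typed [AbsTopI] Thm. 2.6 (v) (`Thm26v`, case
`Θ = {1}`: `Δ` is "the intersection of the open subgroups `H ⊆ Π` such that `ζ̃(H)/ζ̃(Π) = [Π : H]`")
at both cores, through abc-iut-L4-t6's `preservesGeom_of_thm26v`.
([IUTchI] Cor 1.2 p.39) [claim: Mochizuki2012, status: disputed] -/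
theorem map_deltaC_eq_of_thm26v {B : D.E.MLFBase} {B' : D'.E.MLFBase} (h26 : D.E.Thm26v B)
    (h26' : D'.E.Thm26v B') (Θ : D.PiC ≃ₜ* D'.PiC) :
    D.DeltaC.map Θ.toMulEquiv.toMonoidHom = D'.DeltaC :=
  FundamentalExtension.preservesGeom_of_thm26v h26 h26' Θ

/-! ### `Θ(Δ_X) = Δ'_X` from [AbsTopII] Cor. 3.3 (ii) / Rmk. 3.1.1 at the two data -/

/-- `Π_X ⊆ Π_C` is an open subgroup of index `2` whose geometric part `Δ_X = Π_X ∩ Δ_C` is torsion-free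
(`X` is a scheme, [AbsTopI] Lem. 4.1 (iv)) — i.e. `Π_X` belongs to the group-theoretic collection of
[AbsTopII] Cor. 3.3 (ii) (abc-iut-L4-t6's `semiEllipticDoubleCoverSubgroups`), GIVEN the
torsion-freeness `htf`. ([IUTchI] Cor 1.2 p.39) [claim: Mochizuki2012, status: disputed] -/
theorem piX_mem_semiEllipticDoubleCoverSubgroups (htf : IsMulTorsionFree ↥(D.PiX ⊓ D.DeltaC)) :
    D.PiX ∈ semiEllipticDoubleCoverSubgroups D.E :=
  ⟨D.isOpen_piX, D.index_piX, htf⟩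

/-- **"[AbsTopII], Corollary 3.3, (ii) … allow[s] one to reconstruct … `Δ_X ⊆ Δ_C`"** (Cor. 1.2 proof
p. 39): an isomorphism of topological groups `Θ : Π_C ⥲ Π'_C` with `Θ(Δ_C) = Δ'_C` carries `Δ_X` onto
`Δ'_X`, GIVEN (`htf`) that `Δ_X` is torsion-free and (`huniq'`) that every member `J` of the primed
group-theoretic collection of Cor. 3.3 (ii) has geometric part `J ∩ Δ'_C = Δ'_X` ([AbsTopII] Cor. 3.3
(ii) + Rmk. 3.1.1: "the unique finite étale double covering of `C_k̄` by a hyperbolic curve"); the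
transport `Θ(Π_X) ∈` collection is abc-iut-L4-t6's `map_mem_semiEllipticDoubleCoverSubgroups`.
([IUTchI] Cor 1.2 p.39) [claim: Mochizuki2012, status: disputed] -/
theorem map_deltaX_eq_of_semiElliptic (Θ : D.PiC ≃ₜ* D'.PiC)
    (hΘΔ : D.DeltaC.map Θ.toMulEquiv.toMonoidHom = D'.DeltaC)
    (htf : IsMulTorsionFree ↥(D.PiX ⊓ D.DeltaC))
    (huniq' : ∀ J ∈ semiEllipticDoubleCoverSubgroups D'.E, J ⊓ D'.DeltaC = D'.PiX ⊓ D'.DeltaC) :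
    (D.PiX ⊓ D.DeltaC).map Θ.toMulEquiv.toMonoidHom = D'.PiX ⊓ D'.DeltaC := by
  rw [Subgroup.map_inf _ _ _ Θ.injective, hΘΔ]
  exact huniq' _
    (map_mem_semiEllipticDoubleCoverSubgroups Θ hΘΔ (piX_mem_semiEllipticDoubleCoverSubgroups htf))

/-! ### The composite `hcore` / `hcoreC` of p432882 / p433266 from the split inputs -/

/-- **The pair-level anabelian binder of `…Cor12Assembly` / `…Cor12Respd`, DERIVED** (`k`, `k'` NF's):
GIVEN (`hext`) that every bicontinuous isomorphism `A ⥲ A'` (`A = Π_{X̲→}` or `Π_{C̲→}`) extends to an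
isomorphism of topological groups `Θ : Π_C ⥲ Π'_C` ([AbsTopII] Cor. 3.3 (i): the `k`-core reconstructed,
bi-anabelian form), [AbsTopI] Thm. 2.6 (vi) at both cores BY NAME (`Thm26vi`), and the Cor. 3.3 (ii) /
Rmk. 3.1.1 side conditions `htf`, `huniq'`, the extension `Θ` satisfies `Θ(Δ_X) = Δ'_X` and
`Θ(Δ_C) = Δ'_C`. ([IUTchI] Cor 1.2 p.39) [claim: Mochizuki2012, status: disputed] -/
theorem core_extension_of_thm26vi {A : Subgroup D.PiC} {A' : Subgroup D'.PiC} (h26 : D.E.Thm26vi)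
    (h26' : D'.E.Thm26vi) (htf : IsMulTorsionFree ↥(D.PiX ⊓ D.DeltaC))
    (huniq' : ∀ J ∈ semiEllipticDoubleCoverSubgroups D'.E, J ⊓ D'.DeltaC = D'.PiX ⊓ D'.DeltaC)
    (hext : ∀ φ : A ≃* A', Continuous φ → Continuous φ.symm →
      ∃ Θ : D.PiC ≃ₜ* D'.PiC, ∀ x : A, Θ (x : D.PiC) = (φ x : D'.PiC)) :
    ∀ φ : A ≃* A', Continuous φ → Continuous φ.symm →
      ∃ Θ : D.PiC ≃* D'.PiC, Continuous Θ ∧ Continuous Θ.symm ∧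
        (∀ x : A, Θ (x : D.PiC) = (φ x : D'.PiC)) ∧
        (D.PiX ⊓ D.DeltaC).map Θ.toMonoidHom = D'.PiX ⊓ D'.DeltaC ∧
        D.DeltaC.map Θ.toMonoidHom = D'.DeltaC := by
  intro φ hφ hφ'
  obtain ⟨Θ, hΘ⟩ := hext φ hφ hφ'
  have hΔ := map_deltaC_eq_of_thm26vi h26 h26' Θ
  exact ⟨Θ.toMulEquiv, Θ.continuous, Θ.symm.continuous, hΘ,
    map_deltaX_eq_of_semiElliptic Θ hΔ htf huniq', hΔ⟩

/-- The same for `k`, `k'` MLF's, from [AbsTopI] Thm. 2.6 (v) BY NAME (`Thm26v`) at both cores.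
([IUTchI] Cor 1.2 p.39) [claim: Mochizuki2012, status: disputed] -/
theorem core_extension_of_thm26v {A : Subgroup D.PiC} {A' : Subgroup D'.PiC} {B : D.E.MLFBase}
    {B' : D'.E.MLFBase} (h26 : D.E.Thm26v B) (h26' : D'.E.Thm26v B')
    (htf : IsMulTorsionFree ↥(D.PiX ⊓ D.DeltaC))
    (huniq' : ∀ J ∈ semiEllipticDoubleCoverSubgroups D'.E, J ⊓ D'.DeltaC = D'.PiX ⊓ D'.DeltaC)
    (hext : ∀ φ : A ≃* A', Continuous φ → Continuous φ.symm →
      ∃ Θ : D.PiC ≃ₜ* D'.PiC, ∀ x : A, Θ (x : D.PiC) = (φ x : D'.PiC)) :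
    ∀ φ : A ≃* A', Continuous φ → Continuous φ.symm →
      ∃ Θ : D.PiC ≃* D'.PiC, Continuous Θ ∧ Continuous Θ.symm ∧
        (∀ x : A, Θ (x : D.PiC) = (φ x : D'.PiC)) ∧
        (D.PiX ⊓ D.DeltaC).map Θ.toMonoidHom = D'.PiX ⊓ D'.DeltaC ∧
        D.DeltaC.map Θ.toMonoidHom = D'.DeltaC := by
  intro φ hφ hφ'
  obtain ⟨Θ, hΘ⟩ := hext φ hφ hφ'
  have hΔ := map_deltaC_eq_of_thm26v h26 h26' Θ
  exact ⟨Θ.toMulEquiv, Θ.continuous, Θ.symm.continuous, hΘ,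
    map_deltaX_eq_of_semiElliptic Θ hΔ htf huniq', hΔ⟩

/-! ### Corollary 1.2 assembled -/

/-- **Corollary 1.2 (Characteristic Nature of Coverings), `k`, `k'` NF's, with [AbsTopI] Thm. 2.6 (vi)
and the [AbsTopII] Cor. 3.3 (ii) transport supplied BY NAME from layer L4.**  Binders (assumption
labels, never asserted): the printed claims of p. 38 (`ArrowCoveringClaims`), the cusp interfaces
(`CuspGalois`, data), the law `[Π_X : Π_X̲] = l`, the printed ramification of `ε⁰` in `X̲→ → X̲`
(`¬ I_{ε⁰} ⊆ Π_{X̲→}`, GAP-LEDGER G-L5d4g6-1), `Thm26vi` at both cores, the single-datum side conditions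
`htf` (`Δ_X` torsion-free) and `huniq'` (Cor. 3.3 (ii) / Rmk. 3.1.1 at the primed datum), the pure
Cor. 3.3 (i) extension properties `hext` / `hextC`, and the [AbsTopI] Lem. 4.5 (+ Rmk. 1.2.2 (ii))
shapes `hLem45` / `hLem45C` of `…Cor12Assembly` / `…Cor12Respd`.
([IUTchI] Cor 1.2 p.39) [claim: Mochizuki2012, status: disputed] -/
theorem characteristicNatureOfCoverings_of_thm26vi (h : D.ArrowCoveringClaims)
    (h' : D'.ArrowCoveringClaims) (C : D.CuspGalois) (C' : D'.CuspGalois)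
    (hX : D.PiXbar.relIndex D.PiX = D.l) (hX' : D'.PiXbar.relIndex D'.PiX = D'.l)
    (h0 : ¬ D.inertia D.ε0 ≤ D.piXarrow) (h0' : ¬ D'.inertia D'.ε0 ≤ D'.piXarrow)
    (h26 : D.E.Thm26vi) (h26' : D'.E.Thm26vi) (htf : IsMulTorsionFree ↥(D.PiX ⊓ D.DeltaC))
    (huniq' : ∀ J ∈ semiEllipticDoubleCoverSubgroups D'.E, J ⊓ D'.DeltaC = D'.PiX ⊓ D'.DeltaC)
    (hext : ∀ φ : D.piXarrow ≃* D'.piXarrow, Continuous φ → Continuous φ.symm →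
      ∃ Θ : D.PiC ≃ₜ* D'.PiC, ∀ x : D.piXarrow, Θ (x : D.PiC) = (φ x : D'.PiC))
    (hextC : ∀ ψ : D.piCarrow ≃* D'.piCarrow, Continuous ψ → Continuous ψ.symm →
      ∃ Θ : D.PiC ≃ₜ* D'.PiC, ∀ x : D.piCarrow, Θ (x : D.PiC) = (ψ x : D'.PiC))
    (hLem45 : ∀ Θ : D.PiC ≃* D'.PiC, Continuous Θ → Continuous Θ.symm →
      D.PiXbar.map Θ.toMonoidHom = D'.PiXbar →
        (∀ x : D.Cusp, ∃ x' : D'.Cusp, ∃ t' ∈ D'.PiXbar,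
          (D.decomp x).map Θ.toMonoidHom = MulAut.conj t' • D'.decomp x') ∧
        (∀ x' : D'.Cusp, ∃ x : D.Cusp, ∃ t' ∈ D'.PiXbar,
          (D.decomp x).map Θ.toMonoidHom = MulAut.conj t' • D'.decomp x'))
    (hLem45C : ∀ Θ : D.PiC ≃* D'.PiC, Continuous Θ → Continuous Θ.symm →
      D.PiCbar.map Θ.toMonoidHom = D'.PiCbar →
        (∀ x : D.Cusp, x ≠ D.ε0 → ∃ x' : D'.Cusp, x' ≠ D'.ε0 ∧ ∃ t' ∈ D'.PiCbar,
          (D.decomp x).map Θ.toMonoidHom = MulAut.conj t' • D'.decomp x') ∧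
        (∀ x' : D'.Cusp, x' ≠ D'.ε0 → ∃ x : D.Cusp, x ≠ D.ε0 ∧ ∃ t' ∈ D'.PiCbar,
          (D.decomp x).map Θ.toMonoidHom = MulAut.conj t' • D'.decomp x')) :
    D.CharacteristicNatureOfCoverings D' :=
  characteristicNatureOfCoverings_of_anabelian' h h' C C' hX hX' h0 h0'
    (core_extension_of_thm26vi h26 h26' htf huniq' hext) hLem45
    (core_extension_of_thm26vi h26 h26' htf huniq' hextC) hLem45C

/-- **Corollary 1.2, `k`, `k'` MLF's**: the same assembly with [AbsTopI] Thm. 2.6 (v) BY NAME (`Thm26v`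
at both cores, for MLF base data `B`, `B'`). ([IUTchI] Cor 1.2 p.39) [claim: Mochizuki2012, status:
disputed] -/
theorem characteristicNatureOfCoverings_of_thm26v (h : D.ArrowCoveringClaims)
    (h' : D'.ArrowCoveringClaims) (C : D.CuspGalois) (C' : D'.CuspGalois)
    (hX : D.PiXbar.relIndex D.PiX = D.l) (hX' : D'.PiXbar.relIndex D'.PiX = D'.l)
    (h0 : ¬ D.inertia D.ε0 ≤ D.piXarrow) (h0' : ¬ D'.inertia D'.ε0 ≤ D'.piXarrow)
    {B : D.E.MLFBase} {B' : D'.E.MLFBase} (h26 : D.E.Thm26v B) (h26' : D'.E.Thm26v B')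
    (htf : IsMulTorsionFree ↥(D.PiX ⊓ D.DeltaC))
    (huniq' : ∀ J ∈ semiEllipticDoubleCoverSubgroups D'.E, J ⊓ D'.DeltaC = D'.PiX ⊓ D'.DeltaC)
    (hext : ∀ φ : D.piXarrow ≃* D'.piXarrow, Continuous φ → Continuous φ.symm →
      ∃ Θ : D.PiC ≃ₜ* D'.PiC, ∀ x : D.piXarrow, Θ (x : D.PiC) = (φ x : D'.PiC))
    (hextC : ∀ ψ : D.piCarrow ≃* D'.piCarrow, Continuous ψ → Continuous ψ.symm →
      ∃ Θ : D.PiC ≃ₜ* D'.PiC, ∀ x : D.piCarrow, Θ (x : D.PiC) = (ψ x : D'.PiC))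
    (hLem45 : ∀ Θ : D.PiC ≃* D'.PiC, Continuous Θ → Continuous Θ.symm →
      D.PiXbar.map Θ.toMonoidHom = D'.PiXbar →
        (∀ x : D.Cusp, ∃ x' : D'.Cusp, ∃ t' ∈ D'.PiXbar,
          (D.decomp x).map Θ.toMonoidHom = MulAut.conj t' • D'.decomp x') ∧
        (∀ x' : D'.Cusp, ∃ x : D.Cusp, ∃ t' ∈ D'.PiXbar,
          (D.decomp x).map Θ.toMonoidHom = MulAut.conj t' • D'.decomp x'))
    (hLem45C : ∀ Θ : D.PiC ≃* D'.PiC, Continuous Θ → Continuous Θ.symm →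
      D.PiCbar.map Θ.toMonoidHom = D'.PiCbar →
        (∀ x : D.Cusp, x ≠ D.ε0 → ∃ x' : D'.Cusp, x' ≠ D'.ε0 ∧ ∃ t' ∈ D'.PiCbar,
          (D.decomp x).map Θ.toMonoidHom = MulAut.conj t' • D'.decomp x') ∧
        (∀ x' : D'.Cusp, x' ≠ D'.ε0 → ∃ x : D.Cusp, x ≠ D.ε0 ∧ ∃ t' ∈ D'.PiCbar,
          (D.decomp x).map Θ.toMonoidHom = MulAut.conj t' • D'.decomp x')) :
    D.CharacteristicNatureOfCoverings D' :=
  characteristicNatureOfCoverings_of_anabelian' h h' C C' hX hX' h0 h0'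
    (core_extension_of_thm26v h26 h26' htf huniq' hext) hLem45
    (core_extension_of_thm26v h26 h26' htf huniq' hextC) hLem45C

end PuncturedEllipticData

/-! ### At the `K`-level §1 datum of two initial Θ-data (Def. 3.1 (d): `K` a number field) -/

namespace InitialThetaData

open scoped Pointwise
open Literature.AnabelianGeometry.AbsoluteAnabelian
open Literature.AnabelianGeometry.AbsoluteAnabelian.AbsTopII (semiEllipticDoubleCoverSubgroups)

universe u v w u' v'

variable {F : Type u} {K : Type v} {Fbar : Type w} [Field F] [NumberField F] [Field K] [NumberField K]
  [Algebra F K] [Field Fbar] [Algebra F Fbar] [Algebra K Fbar]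
  {E : WeierstrassCurve F} [E.IsElliptic] {l : ℕ} {Pb : BadPlacePredicates K}
  (D : InitialThetaData F K Fbar E l Pb)
  {F' : Type u'} {K' : Type v'} [Field F'] [NumberField F'] [Field K'] [NumberField K'] [Algebra F' K']
  {Fbar' : Type w} [Field Fbar'] [Algebra F' Fbar'] [Algebra K' Fbar']
  {E' : WeierstrassCurve F'} [E'.IsElliptic] {l' : ℕ} {Pb' : BadPlacePredicates K'}
  (D' : InitialThetaData F' K' Fbar' E' l' Pb')

/-- **[IUTchI] Cor. 1.2 between the `K`-level data of two initial Θ-data, the `Δ`-clauses of the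
anabelian inputs supplied from layer L4 BY NAME** (`K`, `K'` number fields: [AbsTopI] Thm. 2.6 (vi)
`Thm26vi` at the cores `Π_{C_K}`, `Π_{C_{K'}}`; [AbsTopII] Cor. 3.3 (ii) transport).  Binders as in
`PuncturedEllipticData.characteristicNatureOfCoverings_of_thm26vi`; the law `[Π_X : Π_X̲] = l` is
DISCHARGED by Def. 3.1 (d) (`pe_relIndex_piXbar_piX`, p434154).  Compared with
`pe_characteristicNatureOfCoverings_of_anabelian` (p434154): its composite binders `hcore`/`hcoreC` are
replaced by `hext`/`hextC` (pure Cor. 3.3 (i) extension) + `Thm26vi` ×2 (abc-iut-L4's node, by name) +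
`htf` + `huniq'`. ([IUTchI] Cor 1.2 p.39) [claim: Mochizuki2012, status: disputed] -/
theorem pe_characteristicNatureOfCoverings_of_thm26vi (h : D.geom.pe.ArrowCoveringClaims)
    (h' : D'.geom.pe.ArrowCoveringClaims) (C : D.geom.pe.CuspGalois) (C' : D'.geom.pe.CuspGalois)
    (h0 : ¬ D.geom.pe.inertia D.geom.pe.ε0 ≤ D.geom.pe.piXarrow)
    (h0' : ¬ D'.geom.pe.inertia D'.geom.pe.ε0 ≤ D'.geom.pe.piXarrow)
    (h26 : D.geom.pe.E.Thm26vi) (h26' : D'.geom.pe.E.Thm26vi)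
    (htf : IsMulTorsionFree ↥(D.geom.pe.PiX ⊓ D.geom.pe.DeltaC))
    (huniq' : ∀ J ∈ semiEllipticDoubleCoverSubgroups D'.geom.pe.E,
      J ⊓ D'.geom.pe.DeltaC = D'.geom.pe.PiX ⊓ D'.geom.pe.DeltaC)
    (hext : ∀ φ : D.geom.pe.piXarrow ≃* D'.geom.pe.piXarrow, Continuous φ → Continuous φ.symm →
      ∃ Θ : D.geom.pe.PiC ≃ₜ* D'.geom.pe.PiC,
        ∀ x : D.geom.pe.piXarrow, Θ (x : D.geom.pe.PiC) = (φ x : D'.geom.pe.PiC))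
    (hextC : ∀ ψ : D.geom.pe.piCarrow ≃* D'.geom.pe.piCarrow, Continuous ψ → Continuous ψ.symm →
      ∃ Θ : D.geom.pe.PiC ≃ₜ* D'.geom.pe.PiC,
        ∀ x : D.geom.pe.piCarrow, Θ (x : D.geom.pe.PiC) = (ψ x : D'.geom.pe.PiC))
    (hLem45 : ∀ Θ : D.geom.pe.PiC ≃* D'.geom.pe.PiC, Continuous Θ → Continuous Θ.symm →
      D.geom.pe.PiXbar.map Θ.toMonoidHom = D'.geom.pe.PiXbar →
        (∀ x : D.geom.pe.Cusp, ∃ x' : D'.geom.pe.Cusp, ∃ t' ∈ D'.geom.pe.PiXbar,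
          (D.geom.pe.decomp x).map Θ.toMonoidHom = MulAut.conj t' • D'.geom.pe.decomp x') ∧
        (∀ x' : D'.geom.pe.Cusp, ∃ x : D.geom.pe.Cusp, ∃ t' ∈ D'.geom.pe.PiXbar,
          (D.geom.pe.decomp x).map Θ.toMonoidHom = MulAut.conj t' • D'.geom.pe.decomp x'))
    (hLem45C : ∀ Θ : D.geom.pe.PiC ≃* D'.geom.pe.PiC, Continuous Θ → Continuous Θ.symm →
      D.geom.pe.PiCbar.map Θ.toMonoidHom = D'.geom.pe.PiCbar →
        (∀ x : D.geom.pe.Cusp, x ≠ D.geom.pe.ε0 → ∃ x' : D'.geom.pe.Cusp, x' ≠ D'.geom.pe.ε0 ∧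
          ∃ t' ∈ D'.geom.pe.PiCbar,
            (D.geom.pe.decomp x).map Θ.toMonoidHom = MulAut.conj t' • D'.geom.pe.decomp x') ∧
        (∀ x' : D'.geom.pe.Cusp, x' ≠ D'.geom.pe.ε0 → ∃ x : D.geom.pe.Cusp, x ≠ D.geom.pe.ε0 ∧
          ∃ t' ∈ D'.geom.pe.PiCbar,
            (D.geom.pe.decomp x).map Θ.toMonoidHom = MulAut.conj t' • D'.geom.pe.decomp x')) :
    D.geom.pe.CharacteristicNatureOfCoverings D'.geom.pe :=
  PuncturedEllipticData.characteristicNatureOfCoverings_of_thm26vi h h' C C' D.pe_relIndex_piXbar_piX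
    D'.pe_relIndex_piXbar_piX h0 h0' h26 h26' htf huniq' hext hextC hLem45 hLem45C

end InitialThetaData

end Literature.IUT.HodgeTheaters
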